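import Mathlib
import Literature.NumberTheory.Transcendental.KZCalculus
import Literature.NumberTheory.Transcendental.SemialgebraicMapsProofs
import Summits.KontsevichZagierPeriods.KontsevichZagierPeriods.Theorems.TorsionLogsNeronTorsionSectorStubCornerChartUpper
import Summits.KontsevichZagierPeriods.KontsevichZagierPeriods.Theorems.TorsionLogsNeronTorsionSectorStubCornerChartLower
import Summits.KontsevichZagierPeriods.KontsevichZagierPeriods.Theorems.TorsionLogsNeronTorsionSectorStubUpperRegular
import Summits.KontsevichZagierPeriods.KontsevichZagierPeriods.Theorems.TorsionLogsNeronTorsionSectorStubSigmaChart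
import Summits.KontsevichZagierPeriods.KontsevichZagierPeriods.Theorems.TorsionLogsNeronTorsionSectorStubGridDataAux
import HarnessLib

/-!
# Crux `TorsionLogs.NeronTorsionSector` (stmt-KontsevichZagierPeriods-14500) — assembly, the corner chart (upper branch)

Helper for the lead's stub `stub_assembly` (line `registered`): discharge of the hypotheses of the landed
`stub_cornerChartUpper` and `stub_sigmaChart` from the landed `stub_upperRegular` and the lower chart data, and
repackaging of their conclusions in the form consumed by the corner steps (`stub_wStepInst`) and the hard log
`stub_logB`: the chart translation `σ` of the upper branch, the chart potentials `Q̂⁺ = Qfp∘(·)⁻²` (bounded) and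
`Ĝ⁺ = Gp∘(·)⁻²` (continuous, non-vanishing) on `[0, s₁]`, the chart derivative of `τ̂`.
[cite: KontsevichZagier2001, §1.2] [cite: SilvermanAEC2009, III.2.3]
-/

noncomputable section

open Set MeasureTheory Filter Topology
open Literature.NumberTheory.Transcendental Literature.ModelTheory.ExponentialFields

-- `Summit.KontsevichZagierPeriods.KontsevichZagierPeriods.…` is the tree's mandated layout (single-conjunct summit).
set_option linter.dupNamespace false

namespace Summit.KontsevichZagierPeriods.KontsevichZagierPeriods.Cruxes.NeronTorsionSector.Translation

/-- Composition of a `ℚ`-semialgebraic function of one variable with a `ℚ`-semialgebraic map of one variable is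
`ℚ`-semialgebraic (Basu–Pollack–Roy, Prop. 2.84, one-variable instance). [cite: BasuPollackRoy2006, Prop. 2.84] -/
theorem asmCorner_semialg_comp {S T : Set ℝ} {g φ : ℝ → ℝ}
    (hS : IsSemialgebraic ℚ {t : Fin 1 → ℝ | t 0 ∈ S})
    (hg : IsSemialgebraicFunOn ℚ {t : Fin 1 → ℝ | t 0 ∈ T} (fun t => g (t 0)))
    (hφ : IsSemialgebraicFunOn ℚ {t : Fin 1 → ℝ | t 0 ∈ S} (fun t => φ (t 0)))
    (hmaps : Set.MapsTo φ S T) :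
    IsSemialgebraicFunOn ℚ {t : Fin 1 → ℝ | t 0 ∈ S} (fun t => g (φ (t 0))) := by
  have hmap : IsSemialgebraicMapOn ℚ {t : Fin 1 → ℝ | t 0 ∈ S} (fun t (_ : Fin 1) => φ (t 0)) :=
    IsSemialgebraicMapOn.of_forall hS fun _ => hφ
  exact IsSemialgebraicFunOn.comp_isSemialgebraicMapOn_holds (g := fun t : Fin 1 → ℝ => g (t 0)) hg hmap
    fun t ht => hmaps ht

/-- **The corner chart, upper branch and the chart translations** (see the module docstring).
[cite: KontsevichZagier2001, §1.2] -/
theorem asmCorner_upper :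
    ∀ (g₂ g₃ e₁ x₁ y₁ x₂ L₁ s₁ : ℝ)
      (f yb sl τ Y3 Qf τ' ybp slp τp Y3p Qfp sl3p X33p Y33p Qf3p Pgp Gp τp' R τh Qh : ℝ → ℝ),
    (∀ x, f x = 4 * x ^ 3 - g₂ * x - g₃) → f e₁ = 0 → 0 < e₁ → (∀ x, e₁ < x → 0 < f x) →
    e₁ < x₁ → y₁ ^ 2 = f x₁ → y₁ < 0 →
    L₁ = (12 * x₁ ^ 2 - g₂) / (2 * y₁) → x₂ = L₁ ^ 2 / 4 - 2 * x₁ → e₁ < x₂ → x₂ < x₁ →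
    IsAlgebraic ℚ g₂ → IsAlgebraic ℚ g₃ → IsAlgebraic ℚ x₁ → IsAlgebraic ℚ y₁ →
    0 < s₁ → s₁ ^ 2 * x₁ = 1 → IsAlgebraic ℚ s₁ →
    yb = (fun x => -Real.sqrt (f x)) →
    sl = (fun x => (4 * x ^ 2 + 4 * x * x₁ + 4 * x₁ ^ 2 - g₂) / (yb x + y₁)) →
    τ = (fun x => sl x ^ 2 / 4 - x - x₁) →
    Y3 = (fun x => -(yb x + sl x * (τ x - x))) →
    Qf = (fun x => sl x / 2 + Y3 x / (2 * τ x) - yb x / (2 * x)) →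
    ybp = (fun x => Real.sqrt (f x)) →
    slp = (fun x => (4 * x ^ 2 + 4 * x * x₁ + 4 * x₁ ^ 2 - g₂) / (ybp x + y₁)) →
    τp = (fun x => slp x ^ 2 / 4 - x - x₁) →
    Y3p = (fun x => -(ybp x + slp x * (τp x - x))) →
    Qfp = (fun x => slp x / 2 + Y3p x / (2 * τp x) - ybp x / (2 * x)) →
    sl3p = (fun x => (4 * τp x ^ 2 + 4 * τp x * x₁ + 4 * x₁ ^ 2 - g₂) / (Y3p x + y₁)) →
    X33p = (fun x => sl3p x ^ 2 / 4 - τp x - x₁) →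
    Y33p = (fun x => -(Y3p x + sl3p x * (X33p x - τp x))) →
    Qf3p = (fun x => sl3p x / 2 + Y33p x / (2 * X33p x) - Y3p x / (2 * τp x)) →
    Pgp = (fun x => 4 * (x + 2 * x₁) * y₁ - L₁ * (4 * x ^ 2 + 4 * x * x₁ + 4 * x₁ ^ 2 - g₂)
      + 4 * (x + 2 * x₁) * ybp x) →
    Gp = (fun x => Pgp x / (ybp x + y₁) ^ 2 * Real.sqrt (x * X33p x) / τp x) →
    τp' = (fun x => Y3p x / ybp x) →
    τ x₁ = x₂ → τ '' Set.Ioi x₁ = Set.Ioo x₂ x₁ → StrictMonoOn τ (Set.Ici x₁) →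
    (∀ x, x₁ ≤ x → HasDerivAt τ (τ' x) x ∧ τ' x ≠ 0 ∧ |τ' x| * Real.sqrt (f x) = Real.sqrt (f (τ x))) →
    (∀ s, 0 < s → s ≤ s₁ → Real.sqrt (f (s ^ 2)⁻¹) = R s / s ^ 3 ∧ τh s = τ (s ^ 2)⁻¹ ∧ Qh s = Qf (s ^ 2)⁻¹) →
    (∀ s ∈ Set.Icc 0 s₁, 0 < R s) → τh 0 = x₁ →
    IsSemialgebraicFunOn ℚ {t : Fin 1 → ℝ | t 0 ∈ Set.Icc 0 s₁} (fun t => Qh (t 0)) →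
    ∃ (σ Qhp Ghp : ℝ → ℝ) (Mb : ℝ),
      (∀ s ∈ Set.Ioo 0 s₁, HasDerivAt τh (τ' (s ^ 2)⁻¹ * (-2 / s ^ 3)) s ∧ τ' (s ^ 2)⁻¹ * (-2 / s ^ 3) ≠ 0 ∧
        |τ' (s ^ 2)⁻¹ * (-2 / s ^ 3)| * R s = 2 * Real.sqrt (f (τh s)) ∧ τh s ∈ Set.Ioo x₂ x₁) ∧
      StrictAntiOn τh (Set.Ioc 0 s₁) ∧ Set.InjOn τh (Set.Ioo 0 s₁) ∧ τh '' Set.Ioo 0 s₁ = Set.Ioo x₂ x₁ ∧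
      (∀ s ∈ Set.Ioo 0 s₁, σ s ∈ Set.Ioo 0 s₁ ∧
        ∃ σ' : ℝ, HasDerivAt σ σ' s ∧ σ' ≠ 0 ∧ |σ'| * R s = R (σ s)) ∧
      StrictAntiOn σ (Set.Icc 0 s₁) ∧ Set.InjOn σ (Set.Ioo 0 s₁) ∧ σ '' Set.Ioo 0 s₁ = Set.Ioo 0 s₁ ∧
      ContinuousOn σ (Set.Icc 0 s₁) ∧
      IsSemialgebraicFunOn ℚ {t : Fin 1 → ℝ | t 0 ∈ Set.Icc 0 s₁} (fun t => σ (t 0)) ∧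
      Set.MapsTo σ (Set.Icc 0 s₁) (Set.Icc 0 s₁) ∧ σ 0 = s₁ ∧ σ s₁ = 0 ∧
      (∀ s, 0 < s → s < s₁ → Qhp s = Qfp (s ^ 2)⁻¹ ∧ (σ s ^ 2)⁻¹ = τp (s ^ 2)⁻¹ ∧ Ghp s = Gp (s ^ 2)⁻¹ ∧
        Qh (σ s) = Qf (τp (s ^ 2)⁻¹) ∧ x₁ < (s ^ 2)⁻¹) ∧
      Qhp 0 = y₁ / (2 * x₁) ∧ ContinuousOn Qhp (Set.Ico 0 s₁) ∧
      IsSemialgebraicFunOn ℚ {t : Fin 1 → ℝ | t 0 ∈ Set.Ico 0 s₁} (fun t => Qhp (t 0)) ∧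
      (∀ s ∈ Set.Ioo 0 s₁, |Qhp s| ≤ Mb) ∧
      ContinuousOn Ghp (Set.Icc 0 s₁) ∧ (∀ s ∈ Set.Icc 0 s₁, Ghp s ≠ 0) ∧
      IsSemialgebraicFunOn ℚ {t : Fin 1 → ℝ | t 0 ∈ Set.Icc 0 s₁} (fun t => Ghp (t 0)) ∧
      IsSemialgebraicFunOn ℚ {t : Fin 1 → ℝ | t 0 ∈ Set.Icc 0 s₁} (fun t => Qh (σ (t 0))) ∧
      (∀ x, x₁ < x → HasDerivAt τp (τp' x) x ∧ τp' x ≠ 0 ∧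
        |τp' x| * Real.sqrt (f x) = Real.sqrt (f (τp x)) ∧ x₁ < τp x ∧
        HasDerivAt Qfp (((g₂ * τp x + 2 * g₃) / (4 * τp x ^ 2) - (g₂ * x + 2 * g₃) / (4 * x ^ 2)) / ybp x) x ∧
        Gp x ≠ 0 ∧ HasDerivAt Gp (Gp x * ((Qf (τp x) - Qfp x) / ybp x)) x) := by
  intro g₂ g₃ e₁ x₁ y₁ x₂ L₁ s₁ f yb sl τ Y3 Qf τ' ybp slp τp Y3p Qfp sl3p X33p Y33p Qf3p Pgp Gp τp' R τh Qh
    hf he₁ he₁0 hfpos hx₁ hy₁ hy₁0 hL₁ hx₂ he₂ hx₂₁ ag₂ ag₃ ax₁ ay₁ hs₁ hs₁x as₁ hyb hsl hτ hY3 hQf hybp hslp hτp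
    hY3p hQfp hsl3p hX33p hY33p hQf3p hPgp hGp hτp' hτx₁ hτimg hτmono hτpt hchart hRpos hτh0 hsQh
  have hx₁0 : 0 < x₁ := he₁0.trans hx₁
  have hx₂0 : 0 < x₂ := he₁0.trans he₂
  -- the upper-branch package
  obtain ⟨U1, U2, U3, U4, ⟨Mb₀, U5⟩, U6⟩ := stub_upperRegular g₂ g₃ e₁ x₁ y₁ x₂ L₁ f yb sl τ Y3 Qf ybp slp τp
    Y3p Qfp sl3p X33p Y33p Qf3p Pgp Gp τp' hf he₁ he₁0 hfpos hx₁ hy₁ hy₁0 hL₁ hx₂ he₂ hx₂₁ ag₂ ag₃ ax₁ ay₁ hyb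
    hsl hτ hY3 hQf hybp hslp hτp hY3p hQfp hsl3p hX33p hY33p hQf3p hPgp hGp hτp'
  have hxpt : ∀ x, x₁ < x → HasDerivAt τp (τp' x) x ∧ τp' x ≠ 0 ∧
      |τp' x| * Real.sqrt (f x) = Real.sqrt (f (τp x)) ∧ x₁ < τp x ∧
      HasDerivAt Qfp (((g₂ * τp x + 2 * g₃) / (4 * τp x ^ 2) - (g₂ * x + 2 * g₃) / (4 * x ^ 2)) / ybp x) x ∧
      Gp x ≠ 0 ∧ HasDerivAt Gp (Gp x * ((Qf (τp x) - Qfp x) / ybp x)) x := by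
    intro x hx
    obtain ⟨hd, hd0, hhaar⟩ := U2 x hx
    obtain ⟨_, _, hG0, hGd, hq3, _⟩ := U3 x hx
    exact ⟨hd, hd0, hhaar, (U1 x hx).2.2.1, U4 x hx, hG0, by rw [← hq3]; exact hGd⟩
  -- chart parameters
  have hinv_gt : ∀ s, 0 < s → s < s₁ → x₁ < (s ^ 2)⁻¹ := by
    intro s hs0 hs
    rw [lt_inv_comm₀ hx₁0 (by positivity)]
    calc s ^ 2 < s₁ ^ 2 := pow_lt_pow_left₀ hs hs0.le two_ne_zero
      _ = x₁⁻¹ := eq_inv_of_mul_eq_one_left hs₁x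
  have hinv_ge : ∀ s, 0 < s → s ≤ s₁ → x₁ ≤ (s ^ 2)⁻¹ := by
    intro s hs0 hs
    rw [le_inv_comm₀ hx₁0 (by positivity)]
    calc s ^ 2 ≤ s₁ ^ 2 := pow_le_pow_left₀ hs0.le hs 2
      _ = x₁⁻¹ := eq_inv_of_mul_eq_one_left hs₁x
  have hrad : ∀ s ∈ Set.Icc (0:ℝ) s₁, 0 < 4 - g₂ * s ^ 4 - g₃ * s ^ 6 := by
    intro s hs
    rcases hs.1.eq_or_lt with h0 | hs0
    · rw [← h0]; norm_num
    · have hfx := hfpos _ (hx₁.trans_le (hinv_ge s hs0 hs.2))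
      rw [hf] at hfx
      have e : 4 - g₂ * s ^ 4 - g₃ * s ^ 6 = s ^ 6 * (4 * (s ^ 2)⁻¹ ^ 3 - g₂ * (s ^ 2)⁻¹ - g₃) := by
        field_simp
      rw [e]; positivity
  have hy₁' : y₁ ^ 2 = 4 * x₁ ^ 3 - g₂ * x₁ - g₃ := by rw [hy₁, hf]
  have hM12 : 0 < 12 * x₁ ^ 2 - g₂ := by
    have := upperReg_M_pos hf he₁ he₁0 hfpos hx₁ hx₁; nlinarith [this]
  have hL₁0 : L₁ ≠ 0 := by
    rw [hL₁]; exact div_ne_zero hM12.ne' (mul_ne_zero two_ne_zero hy₁0.ne)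
  -- the upper chart functions
  set Ru : ℝ → ℝ := fun s => Real.sqrt (4 - g₂ * s ^ 4 - g₃ * s ^ 6) with hRu
  set Mh : ℝ → ℝ := fun s => 4 + 4 * x₁ * s ^ 2 + (4 * x₁ ^ 2 - g₂) * s ^ 4 with hMh
  set Du : ℝ → ℝ := fun s => Ru s + y₁ * s ^ 3 with hDu
  set Ntp : ℝ → ℝ := fun s => 32 * x₁ + 4 * (12 * x₁ ^ 2 - g₂) * s ^ 2 - 8 * y₁ * s * Ru s
      + (16 * x₁ ^ 3 - 4 * g₂ * x₁ + 8 * g₃) * s ^ 4 + (4 * x₁ ^ 2 - g₂) ^ 2 * s ^ 6 with hNtp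
  set τhp : ℝ → ℝ := fun s => Ntp s / (4 * Du s ^ 2) - x₁ with hτhp
  set E : ℝ → ℝ := fun s => Ntp s - 4 * x₁ * Du s ^ 2 with hE
  set σ : ℝ → ℝ := fun s => 2 * Du s / Real.sqrt (E s) with hσ
  set A₁p : ℝ → ℝ := fun s => 4 * x₁ - y₁ * s * Ru s + 4 * x₁ ^ 2 * s ^ 2 + g₃ * s ^ 4 with hA₁p
  set Qhp : ℝ → ℝ := fun s => s * A₁p s / (2 * Du s) - Real.sqrt (f (τhp s)) / (2 * τhp s) with hQhp
  set Khp : ℝ → ℝ := fun s => 4 * Ru s - L₁ * s * Mh s + 8 * x₁ * s ^ 2 * Ru s + 4 * y₁ * s ^ 3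
      + 8 * x₁ * y₁ * s ^ 5 with hKhp
  have hRu2 : ∀ s ∈ Set.Icc (0:ℝ) s₁, Ru s ^ 2 = 4 - g₂ * s ^ 4 - g₃ * s ^ 6 := fun s hs =>
    Real.sq_sqrt (hrad s hs).le
  have hRupos : ∀ s ∈ Set.Icc (0:ℝ) s₁, 0 < Ru s := fun s hs => Real.sqrt_pos.2 (hrad s hs)
  have hRu0 : Ru 0 = 2 := by
    simp only [hRu]
    rw [show (4:ℝ) - g₂ * 0 ^ 4 - g₃ * 0 ^ 6 = 2 ^ 2 by norm_num, Real.sqrt_sq (by norm_num)]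
  have hsqrt_chart : ∀ s, 0 < s → s ≤ s₁ → Real.sqrt (f (s ^ 2)⁻¹) = Ru s / s ^ 3 := by
    intro s hs0 hs
    rw [hf]; exact cornerUp_sqrt_chart hs0 (hrad s ⟨hs0.le, hs⟩).le
  -- `Du > 0` on `[0, s₁)`: `Ru² = s⁶ f(s⁻²) > s⁶ f(x₁) = (y₁ s³)²`
  have hDupos : ∀ s ∈ Set.Ico (0:ℝ) s₁, 0 < Du s := by
    intro s hs
    rcases hs.1.eq_or_lt with h0 | hs0
    · rw [← h0]; simp only [hDu, hRu0]; norm_num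
    · have hsI : s ∈ Set.Icc (0:ℝ) s₁ := ⟨hs0.le, hs.2.le⟩
      have hflt : f x₁ < f (s ^ 2)⁻¹ :=
        gridData_cubic_lt hf he₁ he₁0 hfpos hx₁.le (hinv_gt s hs0 hs.2)
      have h1 : (-(y₁ * s ^ 3)) ^ 2 < Ru s ^ 2 := by
        rw [hRu2 s hsI]
        have hflt' : y₁ ^ 2 < 4 * (s ^ 2)⁻¹ ^ 3 - g₂ * (s ^ 2)⁻¹ - g₃ := by
          rw [hy₁']; rw [hf, hf] at hflt; exact hflt
        have e : 4 - g₂ * s ^ 4 - g₃ * s ^ 6 = s ^ 6 * (4 * (s ^ 2)⁻¹ ^ 3 - g₂ * (s ^ 2)⁻¹ - g₃) := by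
          field_simp
        rw [e, show (-(y₁ * s ^ 3)) ^ 2 = s ^ 6 * y₁ ^ 2 by ring]
        exact mul_lt_mul_of_pos_left hflt' (by positivity)
      have h2 : -(y₁ * s ^ 3) < Ru s := by
        have hnn : 0 ≤ -(y₁ * s ^ 3) := by nlinarith [pow_pos hs0 3]
        exact lt_of_pow_lt_pow_left₀ 2 (hRupos s hsI).le h1
      simp only [hDu]; linarith
  -- `τ̂⁺ = τp ∘ (·)⁻²` on `(0, s₁)`
  have hslp_chart : ∀ s, 0 < s → s < s₁ →
      slp (s ^ 2)⁻¹ = (4 * (s ^ 2)⁻¹ ^ 2 + 4 * (s ^ 2)⁻¹ * x₁ + 4 * x₁ ^ 2 - g₂) / (Ru s / s ^ 3 + y₁) := by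
    intro s hs0 hs
    simp only [hslp, hybp]; rw [hsqrt_chart s hs0 hs.le]
  have hτhp_chart : ∀ s, 0 < s → s < s₁ → τhp s = τp (s ^ 2)⁻¹ := by
    intro s hs0 hs
    have hsI : s ∈ Set.Icc (0:ℝ) s₁ := ⟨hs0.le, hs.le⟩
    have hD : Ru s + y₁ * s ^ 3 ≠ 0 := by
      have := hDupos s ⟨hs0.le, hs⟩; simp only [hDu] at this; exact this.ne'
    have key := cornerUp_tau_chart (g₂ := g₂) (g₃ := g₃) (x₁ := x₁) hs0.ne' hD (hRu2 s hsI) hy₁'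
    have lhs : τhp s = (32 * x₁ + 4 * (12 * x₁ ^ 2 - g₂) * s ^ 2 - 8 * y₁ * s * Ru s +
        (16 * x₁ ^ 3 - 4 * g₂ * x₁ + 8 * g₃) * s ^ 4 + (4 * x₁ ^ 2 - g₂) ^ 2 * s ^ 6) /
        (4 * (Ru s + y₁ * s ^ 3) ^ 2) - x₁ := by
      simp only [hτhp, hNtp, hDu]
    rw [lhs, key]
    simp only [hτp]; rw [hslp_chart s hs0 hs]
  -- positivity of the upper chart data on `[0, s₁)`
  have hNtp0 : Ntp 0 = 32 * x₁ := by simp only [hNtp]; ring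
  have hDu0' : Du 0 = 2 := by simp only [hDu, hRu0]; ring
  have hτhp0' : τhp 0 = x₁ := by simp only [hτhp, hNtp0, hDu0']; ring
  have hτp_range : ∀ x, x₁ < x → τ (τp x) ∈ Set.Ioo x₂ x₁ := by
    intro x hx
    rw [← hτimg]; exact ⟨τp x, (hxpt x hx).2.2.2.1, rfl⟩
  have hτhppos : ∀ s ∈ Set.Ico (0:ℝ) s₁, 0 < τhp s ∧ 0 < f (τhp s) ∧ 0 < τ (τhp s) := by
    intro s hs
    rcases hs.1.eq_or_lt with h0 | hs0
    · rw [← h0, hτhp0', hτx₁]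
      exact ⟨hx₁0, hfpos x₁ hx₁, hx₂0⟩
    · rw [hτhp_chart s hs0 hs.2]
      have hx := hinv_gt s hs0 hs.2
      have hτpx := (hxpt _ hx).2.2.2.1
      exact ⟨hx₁0.trans hτpx, hfpos _ (hx₁.trans hτpx), hx₂0.trans (hτp_range _ hx).1⟩
  -- the landed chart theorem (upper branch)
  have hτ_alt : τ = (fun x => ((4 * x ^ 2 + 4 * x * x₁ + 4 * x₁ ^ 2 - g₂) / (-Real.sqrt (f x) + y₁)) ^ 2 / 4
      - x - x₁) := by
    funext x; simp only [hτ, hsl, hyb]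
  obtain ⟨C3, ⟨_, hEs₁, hEeq, _, hτhp0, hσ0, hσs₁, hQhp0⟩, ⟨_, hcQhp, hcσ⟩, ⟨_, hsQhp, hsσ⟩, CT⟩ :=
    stub_cornerChartUpper g₂ g₃ x₁ y₁ L₁ s₁ f ybp slp τp τ Pgp Ru Mh Du Ntp τhp E σ A₁p Qhp Khp hf hy₁ hy₁0 hx₁0
      hs₁ hs₁x hL₁ ag₂ ag₃ ax₁ ay₁ hybp hslp hτp hτ_alt hPgp rfl rfl rfl rfl rfl rfl rfl rfl rfl rfl hrad hτhppos
  -- `E > 0` on `[0, s₁]`, hence the continuity of `σ` and the extension `T`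
  have hEpos : ∀ s ∈ Set.Icc (0:ℝ) s₁, 0 < E s := by
    intro s hs
    rcases hs.2.eq_or_lt with h1 | hs1
    · rw [h1, hEs₁]
      have h12 : (12 * x₁ ^ 2 - g₂) ≠ 0 := hM12.ne'
      positivity
    · rw [hEeq s ⟨hs.1, hs1⟩]
      have := hDupos s ⟨hs.1, hs1⟩
      have := (hτhppos s ⟨hs.1, hs1⟩).1
      positivity
  have hσc : ContinuousOn σ (Set.Icc 0 s₁) := hcσ hEpos
  obtain ⟨T, hTc, hTeq, hTs₁, hsT, CT2⟩ := CT hEpos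
  have hTpos : ∀ s ∈ Set.Icc (0:ℝ) s₁, 0 < T s := by
    intro s hs
    rcases hs.2.eq_or_lt with h1 | hs1
    · rw [h1, hTs₁]; exact hx₁0
    · rw [hTeq s ⟨hs.1, hs1⟩]; exact (hτhppos s ⟨hs.1, hs1⟩).2.2
  obtain ⟨hGc, hsG, hGagree, hG0, hKs₁⟩ := CT2 hTpos
  set Ghp : ℝ → ℝ := fun s => 4 * Khp s * Real.sqrt (T s) / E s with hGhp
  -- the chart calculus (`stub_sigmaChart`)
  have SC := stub_sigmaChart x₁ x₂ s₁ f τ τ' τp τp' R τh τhp σ hx₁0 hs₁ hs₁x hx₂₁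
    (fun x hx => hfpos x (hx₁.trans_le hx)) (fun s hs0 hs => (hchart s hs0 hs).1) hRpos hτpt hτmono hτimg
    (fun s hs0 hs => (hchart s hs0 hs).2.1) hτh0
    (fun x hx => ⟨(hxpt x hx).1, (hxpt x hx).2.1, (hxpt x hx).2.2.1, (hxpt x hx).2.2.2.1⟩)
    (fun s hs0 hs => ⟨hτhp_chart s hs0 hs, (C3 s hs0 hs).2.2.2.1, (C3 s hs0 hs).2.2.2.2.1⟩) hσ0 hσs₁ hσc
  obtain ⟨Sτh, Sτhanti, Sτhinj, Sτhimg, Sσ, Sσanti, Sσinj, Sσimg⟩ := SC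
  have hσmaps : Set.MapsTo σ (Set.Icc 0 s₁) (Set.Icc 0 s₁) := by
    intro s hs
    have h1 : σ s ≤ σ 0 := Sσanti.antitoneOn (left_mem_Icc.2 hs₁.le) hs hs.1
    have h2 : σ s₁ ≤ σ s := Sσanti.antitoneOn hs (right_mem_Icc.2 hs₁.le) hs.2
    rw [hσ0] at h1; rw [hσs₁] at h2
    exact ⟨h2, h1⟩
  -- agreement of the chart potentials with the x-chart ones on `(0, s₁)`
  have hagree : ∀ s, 0 < s → s < s₁ → Qhp s = Qfp (s ^ 2)⁻¹ ∧ (σ s ^ 2)⁻¹ = τp (s ^ 2)⁻¹ ∧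
      Ghp s = Gp (s ^ 2)⁻¹ ∧ Qh (σ s) = Qf (τp (s ^ 2)⁻¹) ∧ x₁ < (s ^ 2)⁻¹ := by
    intro s hs0 hs
    have hx := hinv_gt s hs0 hs
    obtain ⟨_, hτhps, _, hσsq, hσpos, hQ⟩ := C3 s hs0 hs
    obtain ⟨_, _, _, _, hy3p, _⟩ := U1 _ hx
    obtain ⟨_, _, _, _, _, hx33⟩ := U3 _ hx
    have hσinv : (σ s ^ 2)⁻¹ = τp (s ^ 2)⁻¹ := by
      rw [← hτhps]
      have hτhp_ne : τhp s ≠ 0 := (hτhppos s ⟨hs0.le, hs⟩).1.ne'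
      field_simp
      linarith [hσsq]
    refine ⟨?_, hσinv, ?_, ?_, hx⟩
    · rw [hQ]; simp only [hQfp]; rw [hy3p]; ring
    · simp only [hGhp]
      rw [hGagree s hs0 hs]; simp only [hGp]; rw [hx33]
    · have hσs : σ s ∈ Set.Ioo 0 s₁ := (Sσ s ⟨hs0, hs⟩).1
      rw [(hchart (σ s) hσs.1 hσs.2.le).2.2, hσinv]
  -- boundedness of `Q̂⁺` on `(0, s₁)`
  set sstar : ℝ := (Real.sqrt (x₁ + 1))⁻¹ with hsstar
  have hx₁1 : 0 < x₁ + 1 := by linarith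
  have hsstar_pos : 0 < sstar := by rw [hsstar]; exact inv_pos.2 (Real.sqrt_pos.2 hx₁1)
  have hsstar_sq : sstar ^ 2 = (x₁ + 1)⁻¹ := by rw [hsstar, inv_pow, Real.sq_sqrt hx₁1.le]
  have hsstar_lt : sstar < s₁ := by
    have h1 : sstar ^ 2 < s₁ ^ 2 := by
      rw [hsstar_sq, eq_inv_of_mul_eq_one_left hs₁x]
      exact (inv_lt_inv₀ hx₁1 hx₁0).2 (by linarith)
    exact lt_of_pow_lt_pow_left₀ 2 hs₁.le h1
  obtain ⟨M₁, hM₁⟩ := (isCompact_Icc.image_of_continuousOn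
    (hcQhp.mono (Icc_subset_Ico_right hsstar_lt))).isBounded.subset_closedBall_lt 0 0
  refine ⟨σ, Qhp, Ghp, max M₁ Mb₀, Sτh, Sτhanti, Sτhinj, Sτhimg, Sσ, Sσanti, Sσinj, Sσimg, hσc, hsσ, hσmaps, hσ0,
    hσs₁, hagree, hQhp0, hcQhp, hsQhp, ?_, hGc, ?_, hsG, ?_, hxpt⟩
  · -- the bound
    intro s hs
    rcases le_or_gt s sstar with hle | hgt
    · have hmem := hM₁.2 ⟨s, ⟨hs.1.le, hle⟩, rfl⟩
      rw [Metric.mem_closedBall, dist_zero_right, Real.norm_eq_abs] at hmem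
      exact hmem.trans (le_max_left _ _)
    · rw [(hagree s hs.1 hs.2).1]
      refine (U5 _ ⟨hinv_gt s hs.1 hs.2, ?_⟩).trans (le_max_right _ _)
      -- `(s²)⁻¹ ≤ x₁ + 1` because `s > s⋆ = (x₁+1)^{-1/2}`
      have hs0 : 0 < s := hs.1
      rw [inv_le_comm₀ (by positivity) hx₁1, ← hsstar_sq]
      exact pow_le_pow_left₀ hsstar_pos.le hgt.le 2
  · -- `Ĝ⁺ ≠ 0` on `[0, s₁]`
    intro s hs
    rcases hs.1.eq_or_lt with h0 | hs0
    · rw [← h0]; simp only [hGhp]; rw [hG0]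
      have hT0 : 0 < T 0 := hTpos 0 (left_mem_Icc.2 hs₁.le)
      have : 0 < Real.sqrt (T 0) := Real.sqrt_pos.2 hT0
      positivity
    · rcases hs.2.eq_or_lt with h1 | hs1
      · rw [h1]; simp only [hGhp]; rw [hKs₁, hTs₁, hEs₁]
        have h12 : (12 * x₁ ^ 2 - g₂) ≠ 0 := hM12.ne'
        refine div_ne_zero (mul_ne_zero (mul_ne_zero four_ne_zero (neg_ne_zero.mpr
          (mul_ne_zero (mul_ne_zero hL₁0 (pow_ne_zero 5 hs₁.ne')) h12))) (Real.sqrt_pos.2 hx₁0).ne') ?_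
        exact mul_ne_zero (pow_ne_zero 6 hs₁.ne') (pow_ne_zero 2 h12)
      · rw [(hagree s hs0 hs1).2.2.1]
        exact (hxpt _ (hinv_gt s hs0 hs1)).2.2.2.2.2.1
  · -- `Q̂ ∘ σ` is semialgebraic on `[0, s₁]`
    exact asmCorner_semialg_comp (cornerLower_isSemialgebraic_slab isAlgebraic_zero as₁) hsQh hsσ hσmaps

end Summit.KontsevichZagierPeriods.KontsevichZagierPeriods.Cruxes.NeronTorsionSector.Translation
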